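import Mathlib.Combinatorics.SetFamily.FourFunctions
import Literature.Probability.LatticeModels.RandomClusterEdgeWeights
import HarnessLib

/-!
# FK sub-lane: marginals of `φ_{w,q}` (`q ≥ 1`) satisfy the FKG lattice condition — the "star law" of FK-Q2 §11.2(b) is a theorem

Support file (`--supports stmt-CriticalPhenomena-4575`), FK sub-lane `prim-bschramm-fk-2` (gen 5) of the post-continuity programme;
builds on p205010 (kernel theorem, internal audit signed; external expert review pending).  No definitions, no named facts, no sorries;
standard axioms.

fk-2 gen 2 (FK-Q2.md §11.2) located the failure of the `q = 1` proof of row K (META-A2 / vdBHK Thm 1.1's star + Ahlswede–Daykin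
step) under `φ_{p,q}` (exact `C₄` witness `−2/45` at `q = 2`), and recorded that the LAW OF THE OPEN STAR of a vertex set `Z` nevertheless
stays log-supermodular in every census cell (`0/183,192` at `n ≤ 5`; ttrl cp-hp5 §826.3: `0/62 M` cells at `q = 2` under heavy-star / light-pendant
weights).  This file PROVES it, for every set of pairs `E₀` (not only stars) and every `q ≥ 1`: the marginal of `φ^B_{w,q}` on `{0,1}^{E₀}`
satisfies the FKG lattice condition.  Reason: `φ^B_{w,q}` itself satisfies the lattice condition (`rcWeightW_lattice_condition`, Grimmett
Thm (3.8)), and log-supermodularity is inherited by marginals — Ahlswede–Daykin's four functions theorem (Mathlib `four_functions_theorem`)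
with all four functions equal to the random-cluster weight (Karlin–Rinott's "MTP₂ is closed under marginalisation").

* `FK.rcMeasureW_real_finset_eq` — `φ(𝒜) = (Σ_{ω ∈ 𝒜} w(ω)) / Z` for a finset of configurations;
* `FK.rcMeasureW_real_mul_le_infs_sups` — **Ahlswede–Daykin for `φ^B_{w,q}`, `q ≥ 1`**: `φ(𝒜) φ(ℬ) ≤ φ(𝒜 ⊼ ℬ) φ(𝒜 ⊻ ℬ)` for all finsets of
  configurations (`𝒜 ⊼ ℬ = {a ∩ b}`, `𝒜 ⊻ ℬ = {a ∪ b}`);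
* `FK.rcMeasureW_real_cylinder_lattice` — **the marginal law on any set of pairs `E₀` is log-supermodular**:
  `φ(ω ∩ E₀ = S) φ(ω ∩ E₀ = T) ≤ φ(ω ∩ E₀ = S ∩ T) φ(ω ∩ E₀ = S ∪ T)`; the open-star law of §11.2(b) is the case `E₀ = ` the pairs at `Z`.
[cite: Grimmett2006, Thm. (3.8) eq. (3.11) (p. 16); Thm. (2.16)] [cite: AhlswedeDaykin1978] [cite: KarlinRinott1980] [cite: VandenbergHaggstromKahn2005, p. 9]
-/

noncomputable section

namespace Summit.CriticalPhenomena.PercolationContinuityZ3.Theorems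

open MeasureTheory Set Literature.Probability.LatticeModels Literature.Probability.Percolation
open scoped Classical FinsetFamily

namespace FK

variable {V : Type*} [Fintype V] (w : Sym2 V → unitInterval)

/-- The measure of a finset of configurations as a weight sum over `Z`: `φ(𝒜) = (Σ_{ω ∈ 𝒜} w(ω)) / Z` (`q > 0`).
[cite: Grimmett2006, §1.4 eq. (1.20) (p. 15)] -/
theorem rcMeasureW_real_finset_eq {q : ℝ} (hq : 0 < q) (B : Set V) (𝒜 : Finset (BondConfig V)) :
    (rcMeasureW w q B).real (↑𝒜 : Set (BondConfig V)) = (∑ ω ∈ 𝒜, rcWeightW w q B ω) / rcPartitionFunctionW w q B := by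
  rw [rcMeasureW_real_apply w hq B, Finset.sum_div]
  simp only [Finset.mem_coe]
  rw [Finset.sum_ite_mem, Finset.univ_inter]

/-- **Ahlswede–Daykin for the random-cluster measure `φ^B_{w,q}`, `q ≥ 1`**: for all finsets `𝒜, ℬ` of bond configurations,
`φ(𝒜) · φ(ℬ) ≤ φ(𝒜 ⊼ ℬ) · φ(𝒜 ⊻ ℬ)` where `𝒜 ⊼ ℬ = {a ∩ b : a ∈ 𝒜, b ∈ ℬ}` and `𝒜 ⊻ ℬ = {a ∪ b : a ∈ 𝒜, b ∈ ℬ}` — the four functions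
theorem with all four functions the random-cluster weight, whose hypothesis is the FKG lattice condition `w(a)w(b) ≤ w(a ∩ b)w(a ∪ b)`
(`rcWeightW_lattice_condition`). [cite: AhlswedeDaykin1978] [cite: Grimmett2006, Thm. (3.8) eq. (3.11) (p. 16)] -/
theorem rcMeasureW_real_mul_le_infs_sups {q : ℝ} (hq : 1 ≤ q) (B : Set V) (𝒜 ℬ : Finset (BondConfig V)) :
    (rcMeasureW w q B).real (↑𝒜 : Set (BondConfig V)) * (rcMeasureW w q B).real (↑ℬ : Set (BondConfig V)) ≤
      (rcMeasureW w q B).real (↑(𝒜 ⊼ ℬ) : Set (BondConfig V)) * (rcMeasureW w q B).real (↑(𝒜 ⊻ ℬ) : Set (BondConfig V)) := by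
  have hq0 : 0 < q := one_pos.trans_le hq
  have hZ := rcPartitionFunctionW_pos w hq0 B
  have hnn : 0 ≤ fun ω => rcWeightW w q B ω := fun ω => rcWeightW_nonneg w hq0.le B ω
  have key := four_functions_theorem (fun ω => rcWeightW w q B ω) (fun ω => rcWeightW w q B ω) (fun ω => rcWeightW w q B ω)
    (fun ω => rcWeightW w q B ω) hnn hnn hnn hnn (fun a b => rcWeightW_lattice_condition w hq B a b) 𝒜 ℬ
  rw [rcMeasureW_real_finset_eq w hq0, rcMeasureW_real_finset_eq w hq0, rcMeasureW_real_finset_eq w hq0,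
    rcMeasureW_real_finset_eq w hq0, div_mul_div_comm, div_mul_div_comm]
  exact div_le_div_of_nonneg_right key (mul_pos hZ hZ).le

/-- **The marginal law of `φ^B_{w,q}` (`q ≥ 1`) on ANY set of pairs `E₀` satisfies the FKG lattice condition**: for all local configurations
`S, T`, `φ(ω ∩ E₀ = S) · φ(ω ∩ E₀ = T) ≤ φ(ω ∩ E₀ = S ∩ T) · φ(ω ∩ E₀ = S ∪ T)`.  With `E₀` the pairs meeting a vertex set `Z` this is
the log-supermodularity of the law of the OPEN STAR of `Z` (FK-Q2.md §11.2(b), census-clean; now a theorem for every `q ≥ 1` and every `Z`).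
From `rcMeasureW_real_mul_le_infs_sups`: the pairwise meets of `{ω ∩ E₀ = S}` and `{ω ∩ E₀ = T}` lie in `{ω ∩ E₀ = S ∩ T}`, the joins in
`{ω ∩ E₀ = S ∪ T}`. [cite: AhlswedeDaykin1978] [cite: Grimmett2006, Thm. (3.8) (p. 16), Thm. (2.16)] -/
theorem rcMeasureW_real_cylinder_lattice {q : ℝ} (hq : 1 ≤ q) (B : Set V) (E₀ S T : Set (Sym2 V)) :
    (rcMeasureW w q B).real {ω : BondConfig V | ω ∩ E₀ = S} * (rcMeasureW w q B).real {ω : BondConfig V | ω ∩ E₀ = T} ≤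
      (rcMeasureW w q B).real {ω : BondConfig V | ω ∩ E₀ = S ∩ T} * (rcMeasureW w q B).real {ω : BondConfig V | ω ∩ E₀ = S ∪ T} := by
  have hq0 : 0 < q := one_pos.trans_le hq
  haveI := isProbabilityMeasure_rcMeasureW w hq0 B
  set 𝒜 : Finset (BondConfig V) := Finset.univ.filter (fun ω => ω ∩ E₀ = S) with h𝒜
  set ℬ : Finset (BondConfig V) := Finset.univ.filter (fun ω => ω ∩ E₀ = T) with hℬ
  have hA : {ω : BondConfig V | ω ∩ E₀ = S} = (↑𝒜 : Set (BondConfig V)) := by ext ω; simp [h𝒜]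
  have hB : {ω : BondConfig V | ω ∩ E₀ = T} = (↑ℬ : Set (BondConfig V)) := by ext ω; simp [hℬ]
  have hinf : (↑(𝒜 ⊼ ℬ) : Set (BondConfig V)) ⊆ {ω : BondConfig V | ω ∩ E₀ = S ∩ T} := by
    intro ω hω
    rw [Finset.mem_coe, Finset.mem_infs] at hω
    obtain ⟨a, ha, b, hb, rfl⟩ := hω
    have ha' : a ∩ E₀ = S := by simpa [h𝒜] using ha
    have hb' : b ∩ E₀ = T := by simpa [hℬ] using hb
    show (a ⊓ b) ∩ E₀ = S ∩ T
    rw [← ha', ← hb']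
    ext e; simp only [inf_eq_inter, mem_inter_iff]; tauto
  have hsup : (↑(𝒜 ⊻ ℬ) : Set (BondConfig V)) ⊆ {ω : BondConfig V | ω ∩ E₀ = S ∪ T} := by
    intro ω hω
    rw [Finset.mem_coe, Finset.mem_sups] at hω
    obtain ⟨a, ha, b, hb, rfl⟩ := hω
    have ha' : a ∩ E₀ = S := by simpa [h𝒜] using ha
    have hb' : b ∩ E₀ = T := by simpa [hℬ] using hb
    show (a ⊔ b) ∩ E₀ = S ∪ T
    rw [← ha', ← hb']
    ext e; simp only [sup_eq_union, mem_inter_iff, mem_union]; tauto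
  rw [hA, hB]
  calc (rcMeasureW w q B).real (↑𝒜 : Set (BondConfig V)) * (rcMeasureW w q B).real (↑ℬ : Set (BondConfig V))
      ≤ (rcMeasureW w q B).real (↑(𝒜 ⊼ ℬ) : Set (BondConfig V)) * (rcMeasureW w q B).real (↑(𝒜 ⊻ ℬ) : Set (BondConfig V)) :=
        rcMeasureW_real_mul_le_infs_sups w hq B 𝒜 ℬ
    _ ≤ (rcMeasureW w q B).real {ω : BondConfig V | ω ∩ E₀ = S ∩ T} * (rcMeasureW w q B).real {ω : BondConfig V | ω ∩ E₀ = S ∪ T} :=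
        mul_le_mul (measureReal_mono hinf) (measureReal_mono hsup) measureReal_nonneg measureReal_nonneg

end FK

end Summit.CriticalPhenomena.PercolationContinuityZ3.Theorems

end
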